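import Literature.NumberTheory.EllipticCurves.ComplexTorusAddProofs
import Literature.NumberTheory.EllipticCurves.LatticeEndomorphism
import Literature.NumberTheory.EllipticCurves.TorsionCardinality
import Literature.NumberTheory.Transcendental.OnePeriods
import Mathlib.Analysis.Calculus.InverseFunctionTheorem.Deriv
import Mathlib.Analysis.Analytic.Polynomial
import Mathlib.Analysis.Complex.Polynomial.Basic
import HarnessLib

/-!
# Complex multiplication of the period lattice from an endomorphism of the curve

Topic `NumberTheory/EllipticCurves`; a proofs-only file (theorems only, no definitions, no named
facts) in `namespace PeriodPair`, companion of `LatticeEndomorphism.lean` (which proves the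
converse direction used for the singular moduli: a rational *transformation* of `℘` certifies
complex multiplication).  It supplies the analytic half of the bridge
`End(E) ≠ ℤ ⟹ End(Λ) ≠ ℤ` (Silverman, *AEC*, Thm. VI.4.1(b): every analytic homomorphism
`ℂ/Λ₁ → ℂ/Λ₂` is `z ↦ αz` with `αΛ₁ ⊆ Λ₂`; Thm. VI.5.3: `End(E) ≅ End(Λ)`), i.e. of the named fact
`Literature.NumberTheory.EllipticCurves.periodPair_hasCM_of_hasCM`
(`ComplexMultiplicationJInvariantProofs.lean`), discharged in the sibling
`ComplexMultiplicationPeriodLatticeCMProofs.lean`.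

Silverman's proof lifts a holomorphic group endomorphism of `ℂ/Λ` through the universal cover
and applies Liouville.  The tree has no complex structure on `E(ℂ)` and the endomorphism is only
given on `ℚ̄`-points, so the argument is rearranged to be *local*: with
`π : ℂ →+ E_Λ(ℂ)`, `z ↦ (℘(z), ℘'(z)/2)` (the tree's `PeriodPair.toPointHom`, a surjective
homomorphism with kernel `Λ`, `ComplexTorus.lean`, `ComplexTorusAddProofs.lean`):

* `PeriodPair.exists_local_lift` — if a map `Ψ` on a set `G ⊆ ℂ` satisfies
  `℘(Ψ z) = R(z)`, `℘'(Ψ z)/2 = K(z)` with `R` holomorphic and `K` continuous, then near a point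
  `b ∈ G` with `℘'(Ψ b) ≠ 0` it has a holomorphic lift `F` modulo `Λ` with `℘ ∘ F = R`
  (`F = ℘⁻¹ ∘ R`, inverse function theorem `HasStrictDerivAt.toOpenPartialHomeomorph`; the sign
  in `℘(u) = ℘(v) ⇔ u ≡ ±v` is fixed by continuity);
* `PeriodPair.exists_eq_affine_of_lifts` — if `G` is a dense subgroup and `Ψ` is additive modulo
  `Λ` on `G`, holomorphic lifts `F₁` near `a` and `F₂` near `2a` make
  `F₂(2a + s + t) − F₁(a + s) − F₁(a + t)` a continuous `Λ`-valued (on a dense set, hence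
  everywhere) function of small `(s, t)`, hence constant; so `F₁' ` is constant and `F₁` is affine;
* `PeriodPair.mul_mem_lattice_of_weierstrassP_affine_eq` — `℘(c' + αζ) = N(ζ)/D(ζ)` near a point,
  for `Λ`-periodic `N, D` analytic off `Λ` and `α ≠ 0`, forces `αΛ ⊆ Λ` (identity theorem on a
  connected co-countable open set, then `PeriodPair.mem_lattice_of_weierstrassP_add_eventuallyEq`;
  this abstracts Steps 3–5 of `PeriodPair.mul_mem_lattice_of_transformation`);
* `PeriodPair.hasCM_of_rational_lift` — the analytic core: a subgroup `G ≤ ℂ` containing the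
  division points of `Λ`, and `Ψ` additive modulo `Λ` on `G`, given off finitely many cosets by
  rational functions of `(℘, ℘'/2)` and not congruent to any `z ↦ nz`, force `Λ.HasCM`
  (generic division point `exists_generic_div_point`, the three lemmas above, and `α ∉ ℤ` because
  `Ψ − α` would otherwise vanish modulo `Λ` on a neighbourhood of `0` in `G`, which generates `G`);
* `PeriodPair.hasCM_of_curve_endomorphism` — the same for an abstract group `M ↪ E_Λ(ℂ)` whose
  image contains the torsion, with an additive `φ : M → M` that is a rational map
  `(x, y) ↦ (p₁/q₁, p₂/q₂)` off a finite set and is not `[n]` (the form in which `End_{ℚ̄}(E)`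
  presents itself in the prelude `Isogeny.lean`).

## References

* J. H. Silverman, *The Arithmetic of Elliptic Curves*, 2nd ed., GTM 106, Springer 2009:
  Thm. VI.4.1 (analytic maps `ℂ/Λ₁ → ℂ/Λ₂` are `z ↦ αz`), Thm. VI.5.3 and the display after
  Prop. VI.5.4 (`End(E) ≅ {α ∈ ℂ : αΛ ⊆ Λ}`), Prop. VI.3.6(b). [SilvermanAEC2009]
* E. T. Whittaker, G. N. Watson, *A Course of Modern Analysis*, 4th ed., CUP 1927, §20.3
  (the periods of `℘`).
-/

noncomputable section

open Complex Filter Topology Set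

namespace PeriodPair

variable (L : PeriodPair)

/-! ### A local affine transformation `℘(c' + αζ) = N(ζ)/D(ζ)` with `Λ`-periodic `N, D` forces `αΛ ⊆ Λ` -/

/-- **Complex multiplication from a local affine transformation of `℘`.**  Let `N, D` be
`Λ`-periodic functions analytic off `Λ`, and suppose that near some `z₀ ∉ Λ` with `D(z₀) ≠ 0`
and `c' + αz₀ ∉ Λ` one has `N(ζ) = ℘(c' + αζ)·D(ζ)` (i.e. `℘(c' + αζ) = N(ζ)/D(ζ)`), `α ≠ 0`.
Then `αΛ ⊆ Λ`.  (The two sides of `N = ℘(c' + α·)·D` agree on the connected co-countable open set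
where both are analytic, by the identity theorem; `Λ`-periodicity of the right-hand side then
gives `℘(αl + w) = ℘(w)` near a point, and a local translation symmetry of `℘` is a period,
`PeriodPair.mem_lattice_of_weierstrassP_add_eventuallyEq`.)  This abstracts Steps 3–5 of the
tree's `PeriodPair.mul_mem_lattice_of_transformation` (`N = P(℘)`, `D = Q(℘)`). [folklore] -/
theorem mul_mem_lattice_of_weierstrassP_affine_eq {α c' z₀ : ℂ} (hα : α ≠ 0) {N D : ℂ → ℂ}
    (hN : AnalyticOnNhd ℂ N (L.lattice : Set ℂ)ᶜ) (hD : AnalyticOnNhd ℂ D (L.lattice : Set ℂ)ᶜ)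
    (hNper : ∀ z : ℂ, ∀ l ∈ L.lattice, N (z + l) = N z)
    (hDper : ∀ z : ℂ, ∀ l ∈ L.lattice, D (z + l) = D z)
    (hz₀ : z₀ ∉ L.lattice) (hc : c' + α * z₀ ∉ L.lattice) (hDz₀ : D z₀ ≠ 0)
    (h : ∀ᶠ ζ in 𝓝 z₀, N ζ = ℘[L] (c' + α * ζ) * D ζ) {l : ℂ} (hl : l ∈ L.lattice) :
    α * l ∈ L.lattice := by
  have hopen : IsOpen ((L.lattice : Set ℂ)ᶜ) := L.isClosed_lattice.isOpen_compl
  -- Step 3: `N ζ = ℘(c' + α ζ) D ζ` on `V = {ζ ∉ Λ, c' + αζ ∉ Λ}`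
  set G : ℂ → ℂ := fun ζ ↦ N ζ - ℘[L] (c' + α * ζ) * D ζ with hG
  set V : Set ℂ := {ζ | ζ ∉ L.lattice ∧ c' + α * ζ ∉ L.lattice} with hV
  have hVeq : V = ((L.lattice : Set ℂ) ∪
      (fun m : ℂ ↦ (m - c') / α) '' (L.lattice : Set ℂ))ᶜ := by
    ext ζ
    simp only [hV, mem_setOf_eq, mem_compl_iff, mem_union, mem_image, SetLike.mem_coe, not_or,
      not_exists, not_and]
    constructor
    · rintro ⟨h1, h2⟩
      refine ⟨h1, fun m hm h ↦ h2 ?_⟩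
      have e : c' + α * ((m - c') / α) = m := by field_simp; ring
      rw [← h, e]
      exact hm
    · rintro ⟨h1, h2⟩
      refine ⟨h1, fun h ↦ h2 _ h ?_⟩
      field_simp
      ring
  have hVopen : IsOpen V :=
    (hopen.preimage continuous_id).inter (hopen.preimage (by fun_prop))
  have hVcount : Vᶜ.Countable := by
    rw [hVeq, compl_compl]
    exact L.countable_lattice.union (L.countable_lattice.image _)
  have hVpre : IsPreconnected V := by
    rw [hVeq]
    exact (Set.Countable.isConnected_compl_of_one_lt_rank (by simp)
      (L.countable_lattice.union (L.countable_lattice.image _))).isPreconnected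
  have hGan : AnalyticOnNhd ℂ G V := by
    intro ζ hζ
    have hi : AnalyticAt ℂ (fun ζ : ℂ ↦ c' + α * ζ) ζ := by fun_prop
    have h℘2 : AnalyticAt ℂ (fun ζ : ℂ ↦ ℘[L] (c' + α * ζ)) ζ :=
      (L.analyticOnNhd_weierstrassP (c' + α * ζ) hζ.2).comp (f := fun ζ : ℂ ↦ c' + α * ζ) hi
    exact (hN ζ hζ.1).sub (h℘2.mul (hD ζ hζ.1))
  have hz₀V : z₀ ∈ V := ⟨hz₀, hc⟩
  have hGfreq : ∃ᶠ ζ in 𝓝[≠] z₀, G ζ = (fun _ ↦ (0 : ℂ)) ζ := by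
    have h' : ∀ᶠ ζ in 𝓝[≠] z₀, G ζ = 0 := by
      filter_upwards [mem_nhdsWithin_of_mem_nhds h] with ζ hζ
      simp only [hG, hζ, sub_self]
    exact h'.frequently
  have hGV : EqOn G (fun _ ↦ (0 : ℂ)) V :=
    hGan.eqOn_of_preconnected_of_frequently_eq analyticOnNhd_const hVpre hz₀V hGfreq
  -- Step 4: periodicity gives `℘(α l + w) = ℘(w)` near a point
  set O : Set ℂ := {ζ | ζ ∉ L.lattice ∧ D ζ ≠ 0} with hO
  have hOopen : IsOpen O := by
    rw [isOpen_iff_mem_nhds]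
    rintro ζ ⟨hζ, hζD⟩
    have h2 : ∀ᶠ ξ in 𝓝 ζ, D ξ ≠ 0 := (hD ζ hζ).continuousAt.eventually_ne hζD
    filter_upwards [hopen.mem_nhds hζ, h2] with ξ h1 h2 using ⟨h1, h2⟩
  set W : Set ℂ := V ∩ (fun ζ ↦ ζ + l) ⁻¹' V with hW
  have hWopen : IsOpen W := hVopen.inter (hVopen.preimage (by fun_prop))
  have hWdense : Dense W := by
    have hcount : Wᶜ.Countable := by
      rw [hW, compl_inter]
      refine hVcount.union ?_
      have : ((fun ζ : ℂ ↦ ζ + l) ⁻¹' V)ᶜ = (fun ζ : ℂ ↦ ζ - l) '' Vᶜ := by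
        ext ζ
        simp only [mem_compl_iff, mem_preimage, mem_image]
        constructor
        · intro h
          exact ⟨ζ + l, h, by ring⟩
        · rintro ⟨ξ, hξ, rfl⟩
          simpa using hξ
      rw [this]
      exact hVcount.image _
    simpa using hcount.dense_compl ℝ
  obtain ⟨ζ₁, hζ₁O, hζ₁W⟩ : (O ∩ W).Nonempty :=
    hWdense.inter_open_nonempty O hOopen ⟨z₀, hz₀, hDz₀⟩
  have hper : ∀ᶠ w in 𝓝 (c' + α * ζ₁), ℘[L] (α * l + w) = ℘[L] w := by
    have hOW : O ∩ W ∈ 𝓝 ζ₁ := (hOopen.inter hWopen).mem_nhds ⟨hζ₁O, hζ₁W⟩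
    have hcont : ContinuousAt (fun w : ℂ ↦ (w - c') / α) (c' + α * ζ₁) := by fun_prop
    have e0 : (c' + α * ζ₁ - c') / α = ζ₁ := by
      rw [add_sub_cancel_left, mul_div_cancel_left₀ _ hα]
    have hpre := hcont.preimage_mem_nhds (by rw [e0]; exact hOW)
    filter_upwards [hpre] with w hw
    obtain ⟨ζ, rfl⟩ : ∃ ζ, w = c' + α * ζ := ⟨(w - c') / α, by rw [mul_div_cancel₀ _ hα]; ring⟩
    have e0' : (c' + α * ζ - c') / α = ζ := by
      rw [add_sub_cancel_left, mul_div_cancel_left₀ _ hα]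
    have hw' : ζ ∈ O ∩ W := by simpa only [mem_preimage, e0'] using hw
    obtain ⟨⟨-, hDζ⟩, hζV, hζV'⟩ := hw'
    have hNl : N (ζ + l) = N ζ := hNper ζ l hl
    have hDl : D (ζ + l) = D ζ := hDper ζ l hl
    have e1 := hGV hζV
    have e2 := hGV hζV'
    simp only [hG, hNl, hDl, sub_eq_zero] at e1 e2
    rw [show α * l + (c' + α * ζ) = c' + α * (ζ + l) by ring]
    exact mul_right_cancel₀ hDζ (e2.symm.trans e1)
  -- Step 5: a local translation symmetry of `℘` is a period
  refine L.mem_lattice_of_weierstrassP_add_eventuallyEq hζ₁W.1.2 ?_ hper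
  have := hζ₁W.2.2
  rwa [show c' + α * (ζ₁ + l) = α * l + (c' + α * ζ₁) by ring] at this


/-! ### Division points of `Λ` are dense -/

/-- Every complex number is within `ε` of a division point `l/n` of the lattice (`l ∈ Λ`,
`n ≥ 1`): write `z = xω₁ + yω₂` with `x, y ∈ ℝ` and round `nx, ny` down. [folklore] -/
lemma exists_norm_sub_div_lt (z : ℂ) {ε : ℝ} (hε : 0 < ε) :
    ∃ (n : ℕ) (l : ℂ), 0 < n ∧ l ∈ L.lattice ∧ ‖z - l / n‖ < ε := by
  -- real coordinates of `z`
  set x : ℝ := L.basis.repr z 0 with hx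
  set y : ℝ := L.basis.repr z 1 with hy
  have hz : z = (x : ℂ) * L.ω₁ + (y : ℂ) * L.ω₂ := by
    have h := L.basis.sum_repr z
    rw [Fin.sum_univ_two, basis_zero, basis_one] at h
    rw [← h, hx, hy, Complex.real_smul, Complex.real_smul]
  -- choose `n` with `(‖ω₁‖ + ‖ω₂‖) / n < ε`
  obtain ⟨n, hn⟩ := exists_nat_gt ((‖L.ω₁‖ + ‖L.ω₂‖) / ε)
  have hnpos : (0 : ℝ) < n := lt_of_le_of_lt (by positivity) hn
  have hn0 : 0 < n := by exact_mod_cast hnpos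
  refine ⟨n, (⌊n * x⌋ : ℂ) * L.ω₁ + (⌊n * y⌋ : ℂ) * L.ω₂, hn0,
    L.mem_lattice.2 ⟨⌊n * x⌋, ⌊n * y⌋, rfl⟩, ?_⟩
  have hn' : (n : ℂ) ≠ 0 := by exact_mod_cast hn0.ne'
  have e : z - ((⌊n * x⌋ : ℂ) * L.ω₁ + (⌊n * y⌋ : ℂ) * L.ω₂) / n =
      ((Int.fract (n * x) : ℝ) : ℂ) / n * L.ω₁ + ((Int.fract (n * y) : ℝ) : ℂ) / n * L.ω₂ := by
    rw [hz, Int.fract, Int.fract]; push_cast; field_simp; ring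
  rw [e]
  have h1 : ‖((Int.fract (n * x) : ℝ) : ℂ) / n * L.ω₁‖ ≤ ‖L.ω₁‖ / n := by
    rw [norm_mul, norm_div, Complex.norm_real, Complex.norm_natCast, Real.norm_eq_abs,
      abs_of_nonneg (Int.fract_nonneg _), div_mul_eq_mul_div, div_le_div_iff_of_pos_right hnpos]
    calc Int.fract (↑n * x) * ‖L.ω₁‖ ≤ 1 * ‖L.ω₁‖ :=
          mul_le_mul_of_nonneg_right (Int.fract_lt_one _).le (norm_nonneg _)
      _ = ‖L.ω₁‖ := one_mul _
  have h2 : ‖((Int.fract (n * y) : ℝ) : ℂ) / n * L.ω₂‖ ≤ ‖L.ω₂‖ / n := by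
    rw [norm_mul, norm_div, Complex.norm_real, Complex.norm_natCast, Real.norm_eq_abs,
      abs_of_nonneg (Int.fract_nonneg _), div_mul_eq_mul_div, div_le_div_iff_of_pos_right hnpos]
    calc Int.fract (↑n * y) * ‖L.ω₂‖ ≤ 1 * ‖L.ω₂‖ :=
          mul_le_mul_of_nonneg_right (Int.fract_lt_one _).le (norm_nonneg _)
      _ = ‖L.ω₂‖ := one_mul _
  calc ‖((Int.fract (n * x) : ℝ) : ℂ) / n * L.ω₁ + ((Int.fract (n * y) : ℝ) : ℂ) / n * L.ω₂‖
      ≤ ‖L.ω₁‖ / n + ‖L.ω₂‖ / n := norm_add_le_of_le h1 h2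
    _ = (‖L.ω₁‖ + ‖L.ω₂‖) / n := by ring
    _ < ε := by rwa [div_lt_iff₀ hnpos, mul_comm, ← div_lt_iff₀ hε]

variable {L}

/-- A subgroup of `ℂ` containing all division points of `Λ` is dense. [folklore] -/
lemma dense_of_div_mem {G : AddSubgroup ℂ}
    (hdiv : ∀ n : ℕ, 0 < n → ∀ l ∈ L.lattice, l / n ∈ G) : Dense (G : Set ℂ) := by
  refine Metric.dense_iff.2 fun z ε hε ↦ ?_
  obtain ⟨n, l, hn, hl, hzl⟩ := L.exists_norm_sub_div_lt z hε
  exact ⟨l / n, by simpa [Metric.mem_ball, dist_eq_norm, norm_sub_rev] using hzl, hdiv n hn l hl⟩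

/-- Additivity modulo `Λ` gives `Ψ(m•g) ≡ m•Ψ(g)`. [folklore] -/
lemma sub_nsmul_mem_of_add {G : AddSubgroup ℂ} {Ψ : ℂ → ℂ}
    (hadd : ∀ z ∈ G, ∀ w ∈ G, Ψ (z + w) - Ψ z - Ψ w ∈ L.lattice) {g : ℂ} (hg : g ∈ G) (m : ℕ) :
    Ψ (m * g) - m * Ψ g ∈ L.lattice := by
  induction m with
  | zero =>
    have h := hadd 0 G.zero_mem 0 G.zero_mem
    simp only [add_zero, sub_self, zero_sub, neg_mem_iff] at h
    simpa using h
  | succ m ih =>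
    have hmg : (m : ℂ) * g ∈ G := by simpa using G.nsmul_mem hg m
    have h := hadd (m * g) hmg g hg
    have e : Ψ (((m + 1 : ℕ) : ℂ) * g) - ((m + 1 : ℕ) : ℂ) * Ψ g =
        (Ψ (m * g + g) - Ψ (m * g) - Ψ g) + (Ψ (m * g) - m * Ψ g) := by
      push_cast; ring_nf
    rw [e]
    exact add_mem h ih


/-! ### Local analytic lifts of a map that is rational in `(℘, ℘')` -/

/-- **Local analytic lift.**  Let `Ψ` be a map on a set `G ⊆ ℂ` such that, on an open set `U`,
`℘(Ψ z) = R(z)` and `℘'(Ψ z)/2 = K(z)` for `z ∈ U ∩ G`, with `R` holomorphic and `K` continuous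
on `U`.  If `b ∈ U ∩ G` and `℘'(Ψ b) ≠ 0`, then near `b` there is a holomorphic `F` with
`℘ ∘ F = R` which lifts `Ψ` modulo `Λ` on `G`: `F = ℘⁻¹ ∘ R` for the local inverse `℘⁻¹` of `℘`
at `Ψ b` (inverse function theorem), the sign ambiguity `℘(u) = ℘(v) ⇔ u ≡ ±v` being excluded
by continuity of `K` and `℘' ∘ F`. [folklore] -/
lemma exists_local_lift {G : Set ℂ} {Ψ R K : ℂ → ℂ} {U : Set ℂ} (hU : IsOpen U) {b : ℂ}
    (hbU : b ∈ U) (hbG : b ∈ G) (hR : DifferentiableOn ℂ R U) (hK : ContinuousOn K U)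
    (hΨ : ∀ z ∈ U, z ∈ G → Ψ z ∉ L.lattice ∧ ℘[L] (Ψ z) = R z ∧ ℘'[L] (Ψ z) / 2 = K z)
    (hb' : ℘'[L] (Ψ b) ≠ 0) :
    ∃ ε > 0, ∃ F : ℂ → ℂ, Metric.ball b ε ⊆ U ∧ DifferentiableOn ℂ F (Metric.ball b ε) ∧
      (∀ z ∈ Metric.ball b ε, F z ∉ L.lattice ∧ ℘[L] (F z) = R z) ∧
      (∀ z ∈ Metric.ball b ε, z ∈ G → F z - Ψ z ∈ L.lattice) := by
  obtain ⟨hc, hcR, hcK⟩ := hΨ b hbU hbG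
  set c := Ψ b with hcdef
  have hopen : IsOpen ((L.lattice : Set ℂ)ᶜ) := L.isClosed_lattice.isOpen_compl
  -- the local inverse `g` of `℘` at `c`
  have h℘s : HasStrictDerivAt ℘[L] (℘'[L] c) c := by
    have h1 : HasStrictDerivAt ℘[L] (deriv ℘[L] c) c :=
      ((L.analyticOnNhd_weierstrassP c hc).contDiffAt (n := 1)).hasStrictDerivAt one_ne_zero
    rwa [(L.hasDerivAt_weierstrassP hc).deriv] at h1
  set e := (h℘s.hasStrictFDerivAt_equiv hb').toOpenPartialHomeomorph ℘[L] with he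
  have hecoe : (e : ℂ → ℂ) = ℘[L] := HasStrictFDerivAt.toOpenPartialHomeomorph_coe _
  have hcsrc : c ∈ e.source := HasStrictFDerivAt.mem_toOpenPartialHomeomorph_source _
  have hctgt : ℘[L] c ∈ e.target :=
    HasStrictFDerivAt.image_mem_toOpenPartialHomeomorph_target _
  set g := e.symm with hg
  have hgc : g (℘[L] c) = c := by
    have := e.left_inv hcsrc
    rwa [hecoe] at this
  have hg℘ : ∀ y ∈ e.target, ℘[L] (g y) = y := fun y hy ↦ by
    have := e.right_inv hy
    rwa [hecoe] at this
  have hgcont : ContinuousAt g (R b) := by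
    rw [← hcR]; exact e.continuousAt_symm hctgt
  have hUn : U ∈ 𝓝 b := hU.mem_nhds hbU
  have hRc : ContinuousAt R b := (hR.differentiableAt hUn).continuousAt
  have hKc : ContinuousAt K b := hK.continuousAt hUn
  -- the composite `F := g ∘ R`
  set F : ℂ → ℂ := fun z ↦ g (R z) with hF
  have hFb : F b = c := by simp only [hF, ← hcR, hgc]
  have hFc : ContinuousAt F b := ContinuousAt.comp (g := g) (f := R) (x := b) hgcont hRc
  have h℘'c : ContinuousAt ℘'[L] c := (L.analyticOnNhd_derivWeierstrassP c hc).continuousAt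
  have h℘'Fc : ContinuousAt (fun z ↦ ℘'[L] (F z)) b :=
    ContinuousAt.comp (g := ℘'[L]) (f := F) (x := b) (by rw [hFb]; exact h℘'c) hFc
  -- five conditions holding near `b`
  have ev1 : ∀ᶠ z in 𝓝 b, R z ∈ e.target :=
    hRc.preimage_mem_nhds (by rw [← hcR]; exact e.open_target.mem_nhds hctgt)
  have ev2 : ∀ᶠ z in 𝓝 b, F z ∉ L.lattice :=
    hFc.preimage_mem_nhds (hopen.mem_nhds (by rw [hFb]; exact hc))
  have ev3 : ∀ᶠ z in 𝓝 b, ℘'[L] (F z) ≠ 0 := h℘'Fc.eventually_ne (by rw [hFb]; exact hb')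
  have ev5 : ∀ᶠ z in 𝓝 b, ℘'[L] (F z) + 2 * K z ≠ 0 := by
    have hcont : ContinuousAt (fun z ↦ ℘'[L] (F z) + 2 * K z) b :=
      h℘'Fc.add (hKc.const_smul (2 : ℂ))
    refine hcont.eventually_ne ?_
    rw [hFb, ← hcK]
    ring_nf
    exact mul_ne_zero hb' two_ne_zero
  have ev4 : ∀ᶠ z in 𝓝 b, z ∈ U := hUn
  obtain ⟨ε, hε, hball⟩ := Metric.mem_nhds_iff.1 (ev1.and (ev2.and (ev3.and (ev4.and ev5))))
  refine ⟨ε, hε, F, fun z hz ↦ (hball hz).2.2.2.1, fun z hz ↦ ?_, fun z hz ↦ ?_,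
    fun z hz hzG ↦ ?_⟩
  · -- differentiability
    obtain ⟨h1, h2, h3, h4, -⟩ := hball hz
    have hd℘ : HasDerivAt e (℘'[L] (F z)) (e.symm (R z)) := by
      rw [hecoe]; exact L.hasDerivAt_weierstrassP h2
    have hdg : HasDerivAt g (℘'[L] (F z))⁻¹ (R z) := e.hasDerivAt_symm h1 h3 hd℘
    exact (hdg.differentiableAt.comp z (hR.differentiableAt (hU.mem_nhds h4))).differentiableWithinAt
  · obtain ⟨h1, h2, -, -, -⟩ := hball hz
    exact ⟨h2, hg℘ _ h1⟩
  · obtain ⟨h1, h2, -, h4, h5⟩ := hball hz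
    obtain ⟨hΨz, hΨR, hΨK⟩ := hΨ z h4 hzG
    have h℘eq : ℘[L] (Ψ z) = ℘[L] (F z) := by rw [hΨR, hg℘ _ h1]
    rcases (L.weierstrassP_eq_weierstrassP_iff hΨz h2).1 h℘eq with hplus | hminus
    · exfalso
      apply h5
      have e1 : ℘'[L] (Ψ z) = -℘'[L] (F z) := by
        rw [← L.derivWeierstrassP_sub_coe (Ψ z) ⟨Ψ z + F z, hplus⟩]
        rw [show Ψ z - ((⟨Ψ z + F z, hplus⟩ : L.lattice) : ℂ) = -F z by push_cast; ring]
        exact L.derivWeierstrassP_neg (F z)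
      linear_combination e1 - 2 * hΨK
    · simpa using neg_mem hminus


/-! ### Compatible local lifts of an additive map are affine -/

/-- **Local lifts of an additive map are affine.**  Let `G ≤ ℂ` be dense, `Ψ` additive on `G`
modulo `Λ`, and let `F₁` (near `a ∈ G`) and `F₂` (near `2a`) be holomorphic lifts of `Ψ` modulo
`Λ` on `G`.  Then `F₁` is affine near `a`: the continuous function
`Φ(s, t) = F₂(2a + s + t) − F₁(a + s) − F₁(a + t)` takes values in the discrete closed set `Λ`
on the dense set of `(s, t)` with `s, t ∈ G` small, hence is constant; differentiating in `s`
and in `t` gives `F₁'(a + s) = F₂'(2a + s + t) = F₁'(a + t)`. [folklore] -/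
lemma exists_eq_affine_of_lifts {G : AddSubgroup ℂ} (hdense : Dense (G : Set ℂ)) {Ψ : ℂ → ℂ}
    (hadd : ∀ z ∈ G, ∀ w ∈ G, Ψ (z + w) - Ψ z - Ψ w ∈ L.lattice) {a : ℂ} (ha : a ∈ G)
    {ε₁ ε₂ : ℝ} (hε₁ : 0 < ε₁) (hε₂ : 0 < ε₂) {F₁ F₂ : ℂ → ℂ}
    (hF₁ : DifferentiableOn ℂ F₁ (Metric.ball a ε₁))
    (hF₂ : DifferentiableOn ℂ F₂ (Metric.ball (a + a) ε₂))
    (hF₁Ψ : ∀ z ∈ Metric.ball a ε₁, z ∈ G → F₁ z - Ψ z ∈ L.lattice)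
    (hF₂Ψ : ∀ z ∈ Metric.ball (a + a) ε₂, z ∈ G → F₂ z - Ψ z ∈ L.lattice) :
    ∃ α β : ℂ, ∃ ε > 0, ε ≤ ε₁ ∧ ∀ z ∈ Metric.ball a ε, F₁ z = α * z + β := by
  set ε := min ε₁ (ε₂ / 2) with hεdef
  have hε : 0 < ε := lt_min hε₁ (by linarith)
  have hεle₁ : ε ≤ ε₁ := min_le_left _ _
  have hεle₂ : 2 * ε ≤ ε₂ := by have := min_le_right ε₁ (ε₂ / 2); linarith
  set Φ : ℂ × ℂ → ℂ := fun p ↦ F₂ (a + a + p.1 + p.2) - F₁ (a + p.1) - F₁ (a + p.2) with hΦ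
  set B : Set ℂ := Metric.ball (0 : ℂ) ε with hB
  have hB0 : (0 : ℂ) ∈ B := Metric.mem_ball_self hε
  have hmem₁ : ∀ s ∈ B, a + s ∈ Metric.ball a ε₁ := by
    intro s hs
    simp only [hB, Metric.mem_ball, dist_zero_right] at hs
    simp only [Metric.mem_ball, dist_eq_norm, add_sub_cancel_left]
    exact lt_of_lt_of_le hs hεle₁
  have hmem₂ : ∀ s ∈ B, ∀ t ∈ B, a + a + s + t ∈ Metric.ball (a + a) ε₂ := by
    intro s hs t ht
    simp only [hB, Metric.mem_ball, dist_zero_right] at hs ht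
    simp only [Metric.mem_ball, dist_eq_norm]
    calc ‖a + a + s + t - (a + a)‖ = ‖s + t‖ := by ring_nf
      _ ≤ ‖s‖ + ‖t‖ := norm_add_le _ _
      _ < ε₂ := by linarith
  -- (i) `Φ ∈ Λ` at small `s, t ∈ G`
  have hΦΛ : ∀ s ∈ B, ∀ t ∈ B, s ∈ G → t ∈ G → Φ (s, t) ∈ L.lattice := by
    intro s hs t ht hsG htG
    have hst : a + a + s + t ∈ G := by
      rw [show a + a + s + t = (a + s) + (a + t) by ring]
      exact G.add_mem (G.add_mem ha hsG) (G.add_mem ha htG)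
    have h1 := hF₂Ψ _ (hmem₂ s hs t ht) hst
    have h2 := hF₁Ψ _ (hmem₁ s hs) (G.add_mem ha hsG)
    have h3 := hF₁Ψ _ (hmem₁ t ht) (G.add_mem ha htG)
    have h4 := hadd (a + s) (G.add_mem ha hsG) (a + t) (G.add_mem ha htG)
    have e : Φ (s, t) = (F₂ (a + a + s + t) - Ψ (a + a + s + t)) - (F₁ (a + s) - Ψ (a + s))
        - (F₁ (a + t) - Ψ (a + t)) + (Ψ (a + s + (a + t)) - Ψ (a + s) - Ψ (a + t)) := by
      simp only [hΦ]
      rw [show a + s + (a + t) = a + a + s + t by ring]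
      ring
    rw [e]
    exact add_mem (sub_mem (sub_mem h1 h2) h3) h4
  -- (ii) continuity of `Φ`
  have hc₂ : ContinuousOn (fun p : ℂ × ℂ ↦ F₂ (a + a + p.1 + p.2)) (B ×ˢ B) :=
    hF₂.continuousOn.comp (by fun_prop) fun p hp ↦ hmem₂ _ hp.1 _ hp.2
  have hc₁ : ContinuousOn (fun p : ℂ × ℂ ↦ F₁ (a + p.1)) (B ×ˢ B) :=
    hF₁.continuousOn.comp (by fun_prop) fun p hp ↦ hmem₁ _ hp.1
  have hc₁' : ContinuousOn (fun p : ℂ × ℂ ↦ F₁ (a + p.2)) (B ×ˢ B) :=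
    hF₁.continuousOn.comp (by fun_prop) fun p hp ↦ hmem₁ _ hp.2
  have hΦcont : ContinuousOn Φ (B ×ˢ B) := (hc₂.sub hc₁).sub hc₁'
  -- (iii) `Φ ∈ Λ` on all of `B × B`, by density and closedness of `Λ`
  have hΦΛ' : MapsTo Φ (B ×ˢ B) (L.lattice : Set ℂ) := by
    intro p hp
    have hsub : B ×ˢ B ⊆ closure ((B ∩ (G : Set ℂ)) ×ˢ (B ∩ (G : Set ℂ))) := by
      have h1 : B ⊆ closure (B ∩ (G : Set ℂ)) :=
        hdense.open_subset_closure_inter Metric.isOpen_ball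
      rw [closure_prod_eq]
      exact Set.prod_mono h1 h1
    have hcw : ContinuousWithinAt Φ ((B ∩ (G : Set ℂ)) ×ˢ (B ∩ (G : Set ℂ))) p :=
      (hΦcont.continuousWithinAt hp).mono (Set.prod_mono inter_subset_left inter_subset_left)
    have hmem := hcw.mem_closure_image (hsub hp)
    have himg : Φ '' ((B ∩ (G : Set ℂ)) ×ˢ (B ∩ (G : Set ℂ))) ⊆ L.lattice := by
      rintro _ ⟨⟨s, t⟩, ⟨⟨hs, hsG⟩, ⟨ht, htG⟩⟩, rfl⟩
      exact hΦΛ s hs t ht hsG htG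
    exact L.isClosed_lattice.closure_subset_iff.2 himg hmem
  -- (iv) `Φ` is constant on `B × B`
  have hpre : IsPreconnected (B ×ˢ B) :=
    (convex_ball (0 : ℂ) ε).isPreconnected.prod (convex_ball (0 : ℂ) ε).isPreconnected
  have hdisc : IsDiscrete (L.lattice : Set ℂ) :=
    SetLike.isDiscrete_iff_discreteTopology.2 inferInstance
  have hconst : ∀ p ∈ B ×ˢ B, Φ p = Φ (0, 0) := fun p hp ↦
    hpre.constant_of_mapsTo hdisc hΦcont hΦΛ' hp ⟨hB0, hB0⟩
  -- (v) derivatives: `F₂'(2a + s + t) = F₁'(a + s)`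
  have hderiv : ∀ s ∈ B, ∀ t ∈ B, deriv F₂ (a + a + s + t) = deriv F₁ (a + s) := by
    intro s hs t ht
    have hd₂ : HasDerivAt (fun σ ↦ F₂ (a + a + σ + t)) (deriv F₂ (a + a + s + t)) s := by
      have h := (hF₂.differentiableAt (Metric.isOpen_ball.mem_nhds (hmem₂ s hs t ht))).hasDerivAt
      exact HasDerivAt.comp_const_add (a + a) s (HasDerivAt.comp_add_const (a + a + s) t h)
    have hd₁ : HasDerivAt (fun σ ↦ F₁ (a + σ)) (deriv F₁ (a + s)) s := by
      have h := (hF₁.differentiableAt (Metric.isOpen_ball.mem_nhds (hmem₁ s hs))).hasDerivAt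
      exact HasDerivAt.comp_const_add a s h
    have hdΦ : HasDerivAt (fun σ ↦ Φ (σ, t)) (deriv F₂ (a + a + s + t) - deriv F₁ (a + s)) s := by
      have := (hd₂.sub hd₁).sub_const (F₁ (a + t))
      simpa [hΦ] using this
    have hconst' : (fun σ ↦ Φ (σ, t)) =ᶠ[𝓝 s] fun _ ↦ Φ (0, 0) := by
      filter_upwards [Metric.isOpen_ball.mem_nhds hs] with σ hσ
      exact hconst (σ, t) ⟨hσ, ht⟩
    have h0 : HasDerivAt (fun σ ↦ Φ (σ, t)) 0 s :=
      (hasDerivAt_const s (Φ (0, 0))).congr_of_eventuallyEq hconst'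
    exact sub_eq_zero.1 (hdΦ.unique h0)
  -- (vi) `F₁'` is constant on `ball a ε`
  set α := deriv F₁ a with hα
  have hderiv₁ : ∀ z ∈ Metric.ball a ε, deriv F₁ z = α := by
    intro z hz
    have hs : z - a ∈ B := by
      simpa [hB, Metric.mem_ball, dist_eq_norm] using hz
    have e1 := hderiv (z - a) hs 0 hB0
    have e2 := hderiv 0 hB0 (z - a) hs
    rw [show a + a + (z - a) + 0 = a + a + 0 + (z - a) by ring, e2, add_zero,
      show a + (z - a) = z by ring] at e1
    exact e1.symm
  -- (vii) integrate
  have hdiff : DifferentiableOn ℂ (fun z ↦ F₁ z - z * α) (Metric.ball a ε) :=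
    (hF₁.mono (Metric.ball_subset_ball hεle₁)).sub (by fun_prop)
  obtain ⟨β, hβ⟩ := Metric.isOpen_ball.exists_is_const_of_deriv_eq_zero
    (convex_ball a ε).isPreconnected hdiff (fun z hz ↦ by
      have hF₁z : DifferentiableAt ℂ F₁ z :=
        hF₁.differentiableAt (Metric.isOpen_ball.mem_nhds (Metric.ball_subset_ball hεle₁ hz))
      rw [Pi.zero_apply, (hF₁z.hasDerivAt.fun_sub (hasDerivAt_mul_const α)).deriv, hderiv₁ z hz,
        sub_self])
  exact ⟨α, β, ε, hε, hεle₁, fun z hz ↦ by linear_combination hβ z hz⟩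


/-! ### Generic division points -/

/-- If `cω₁/n ≡ cω₁/m (mod Λ)` with `0 < c ≤ 2` and `n, m ≥ 3` then `n = m`
(`c/n − c/m` is an integer of absolute value `< 1`). [folklore] -/
lemma nat_eq_of_div_sub_div_mem {c : ℚ} (hc0 : 0 < c) (hc : c ≤ 2) {n m : ℕ} (hn : 3 ≤ n)
    (hm : 3 ≤ m) (h : (c : ℂ) * L.ω₁ / n - (c : ℂ) * L.ω₁ / m ∈ L.lattice) : n = m := by
  set q : ℚ := c / n - c / m with hq
  have hn0 : (0 : ℚ) < n := by exact_mod_cast (by omega : 0 < n)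
  have hm0 : (0 : ℚ) < m := by exact_mod_cast (by omega : 0 < m)
  have hmem : (q : ℂ) * L.ω₁ + ((0 : ℚ) : ℂ) * L.ω₂ ∈ L.lattice := by
    have e : (q : ℂ) * L.ω₁ + ((0 : ℚ) : ℂ) * L.ω₂ = (c : ℂ) * L.ω₁ / n - (c : ℂ) * L.ω₁ / m := by
      rw [hq]; push_cast; ring
    rwa [e]
  have hden : q.den = 1 := (L.mul_ω₁_add_mul_ω₂_mem_lattice.1 hmem).1
  have hnum : (q.num : ℚ) = q := (Rat.den_eq_one_iff q).1 hden
  -- `|q| < 1`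
  have h3n : c / n ≤ c / 3 := div_le_div_of_nonneg_left hc0.le (by norm_num) (by exact_mod_cast hn)
  have h3m : c / m ≤ c / 3 := div_le_div_of_nonneg_left hc0.le (by norm_num) (by exact_mod_cast hm)
  have hqn : 0 < c / n := div_pos hc0 hn0
  have hqm : 0 < c / m := div_pos hc0 hm0
  have habs : |q| < 1 := by
    rw [abs_lt, hq]
    constructor <;> linarith
  have hq0 : q = 0 := by
    rw [← hnum] at habs ⊢
    have : |q.num| < 1 := by exact_mod_cast habs
    rw [Int.abs_lt_one_iff.1 this, Int.cast_zero]
  -- hence `n = m`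
  have : (c : ℚ) / n = c / m := by linarith [hq0]
  rw [div_eq_div_iff hn0.ne' hm0.ne'] at this
  have hmn : (m : ℚ) = n := mul_left_cancel₀ hc0.ne' this
  exact_mod_cast hmn.symm

/-- Given finitely many cosets `t + Λ`, some division point `a = ω₁/n` has both `a` and `2a`
outside all of them. [folklore] -/
lemma exists_generic_div_point (T : Finset ℂ) :
    ∃ n : ℕ, 0 < n ∧ (∀ t ∈ T, L.ω₁ / n - t ∉ L.lattice) ∧
      (∀ t ∈ T, L.ω₁ / n + L.ω₁ / n - t ∉ L.lattice) := by
  set Bad : Set ℕ := ⋃ t ∈ (T : Set ℂ), ({n : ℕ | 3 ≤ n ∧ L.ω₁ / n - t ∈ L.lattice} ∪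
    {n : ℕ | 3 ≤ n ∧ L.ω₁ / n + L.ω₁ / n - t ∈ L.lattice}) with hBad
  have hfin : Bad.Finite := by
    refine Set.Finite.biUnion T.finite_toSet fun t _ ↦ Set.Finite.union ?_ ?_
    · refine Set.Subsingleton.finite ?_
      rintro n ⟨hn, hnt⟩ m ⟨hm, hmt⟩
      refine L.nat_eq_of_div_sub_div_mem (c := 1) one_pos (by norm_num) hn hm ?_
      have := sub_mem hnt hmt
      convert this using 1
      push_cast; ring
    · refine Set.Subsingleton.finite ?_
      rintro n ⟨hn, hnt⟩ m ⟨hm, hmt⟩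
      refine L.nat_eq_of_div_sub_div_mem (c := 2) two_pos le_rfl hn hm ?_
      have := sub_mem hnt hmt
      convert this using 1
      push_cast; ring
  obtain ⟨N, hN⟩ := hfin.bddAbove
  have hnot : max N 3 + 1 ∉ Bad := fun h ↦ by have := hN h; omega
  refine ⟨max N 3 + 1, by omega, fun t ht hmem ↦ hnot ?_, fun t ht hmem ↦ hnot ?_⟩
  · exact Set.mem_biUnion (Finset.mem_coe.2 ht) (Or.inl ⟨by omega, hmem⟩)
  · exact Set.mem_biUnion (Finset.mem_coe.2 ht) (Or.inr ⟨by omega, hmem⟩)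

/-! ### The analytic core: a rational lift of a non-scalar additive map forces complex multiplication -/

/-- **Complex multiplication of `Λ` from a non-scalar additive map that is rational in
`(℘, ℘')`.**  Let `G ≤ ℂ` contain all division points of `Λ`, and let `Ψ : G → ℂ` be additive
modulo `Λ` and, off finitely many cosets of `Λ` (`T + Λ`), be given through `℘` by rational
functions of `(℘(z), ℘'(z)/2)`: `℘(Ψ z) = (p₁/q₁)(℘ z, ℘' z/2)`, `℘'(Ψ z)/2 = (p₂/q₂)(℘ z, ℘' z/2)`
(with `Ψ z` off `Λ` and off the `2`-division points).  If `Ψ` is not congruent to `z ↦ nz`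
modulo `Λ` on `G` for any integer `n`, then `Λ` has complex multiplication.

This is the analytic content of "`End(E) ↪ End(Λ)`" (Silverman, *AEC*, VI.4.1(b) and VI.5.3):
a local holomorphic lift of `Ψ` exists near a generic division point (`exists_local_lift`), it
is affine `z ↦ αz + β` by additivity (`exists_eq_affine_of_lifts`), `α ∉ ℤ` because `Ψ ≢ n`,
and `℘(αz + β) = (p₁/q₁)(℘ z, ℘' z/2)` near a point forces `αΛ ⊆ Λ`
(`mul_mem_lattice_of_weierstrassP_affine_eq`).
[cite: SilvermanAEC2009, Thm. VI.4.1(b) and Thm. VI.5.3] -/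
theorem hasCM_of_rational_lift (G : AddSubgroup ℂ)
    (hdiv : ∀ n : ℕ, 0 < n → ∀ l ∈ L.lattice, l / n ∈ G)
    (Ψ : ℂ → ℂ) (hadd : ∀ z ∈ G, ∀ w ∈ G, Ψ (z + w) - Ψ z - Ψ w ∈ L.lattice)
    (p₁ q₁ p₂ q₂ : MvPolynomial (Fin 2) ℂ) (T : Finset ℂ)
    (hrat : ∀ z ∈ G, (∀ t ∈ T, z - t ∉ L.lattice) →
      z ∉ L.lattice ∧ Ψ z ∉ L.lattice ∧ ℘'[L] (Ψ z) ≠ 0 ∧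
      MvPolynomial.eval ![℘[L] z, ℘'[L] z / 2] q₁ ≠ 0 ∧
      MvPolynomial.eval ![℘[L] z, ℘'[L] z / 2] q₂ ≠ 0 ∧
      ℘[L] (Ψ z) = MvPolynomial.eval ![℘[L] z, ℘'[L] z / 2] p₁ /
        MvPolynomial.eval ![℘[L] z, ℘'[L] z / 2] q₁ ∧
      ℘'[L] (Ψ z) / 2 = MvPolynomial.eval ![℘[L] z, ℘'[L] z / 2] p₂ /
        MvPolynomial.eval ![℘[L] z, ℘'[L] z / 2] q₂)
    (hnint : ∀ n : ℤ, ∃ z ∈ G, Ψ z - n * z ∉ L.lattice) : L.HasCM := by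
  have hopen : IsOpen ((L.lattice : Set ℂ)ᶜ) := L.isClosed_lattice.isOpen_compl
  -- the coordinate functions `(℘, ℘'/2)` and the four functions `p_i(℘, ℘'/2)`, `q_i(℘, ℘'/2)`
  set v : ℂ → Fin 2 → ℂ := fun z ↦ ![℘[L] z, ℘'[L] z / 2] with hv
  have hvan : ∀ z ∉ L.lattice, ∀ i, AnalyticAt ℂ (fun z ↦ v z i) z := by
    intro z hz i
    fin_cases i
    · simpa [hv] using L.analyticOnNhd_weierstrassP z hz
    · have h2 : AnalyticAt ℂ (fun x ↦ ℘'[L] x / 2) z :=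
        (L.analyticOnNhd_derivWeierstrassP z hz).div_const
      simpa [hv] using h2
  have han : ∀ p : MvPolynomial (Fin 2) ℂ,
      AnalyticOnNhd ℂ (fun z ↦ MvPolynomial.eval (v z) p) (L.lattice : Set ℂ)ᶜ := by
    intro p z hz
    have := AnalyticAt.aeval_mvPolynomial (hvan z hz) p
    simpa only [MvPolynomial.aeval_eq_eval] using this
  have hper : ∀ p : MvPolynomial (Fin 2) ℂ, ∀ z : ℂ, ∀ l ∈ L.lattice,
      MvPolynomial.eval (v (z + l)) p = MvPolynomial.eval (v z) p := by
    intro p z l hl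
    have h1 : ℘[L] (z + l) = ℘[L] z := by simpa using L.weierstrassP_add_coe z ⟨l, hl⟩
    have h2 : ℘'[L] (z + l) = ℘'[L] z := by simpa using L.derivWeierstrassP_add_coe z ⟨l, hl⟩
    simp only [hv, h1, h2]
  set N₁ : ℂ → ℂ := fun z ↦ MvPolynomial.eval (v z) p₁ with hN₁
  set D₁ : ℂ → ℂ := fun z ↦ MvPolynomial.eval (v z) q₁ with hD₁
  set N₂ : ℂ → ℂ := fun z ↦ MvPolynomial.eval (v z) p₂ with hN₂
  set D₂ : ℂ → ℂ := fun z ↦ MvPolynomial.eval (v z) q₂ with hD₂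
  -- the bad cosets and the open set `U`
  set Bset : Set ℂ := {z | ∃ t ∈ T, z - t ∈ L.lattice} with hBset
  have hBclosed : IsClosed Bset := by
    have : Bset = ⋃ t ∈ (T : Set ℂ), (fun z ↦ z - t) ⁻¹' (L.lattice : Set ℂ) := by
      ext z; simp [hBset]
    rw [this]
    exact T.finite_toSet.isClosed_biUnion fun t _ ↦ L.isClosed_lattice.preimage (by fun_prop)
  have hgood : ∀ z, z ∉ Bset → ∀ t ∈ T, z - t ∉ L.lattice :=
    fun z hz t ht hmem ↦ hz ⟨t, ht, hmem⟩
  set U : Set ℂ := {z | z ∉ L.lattice ∧ D₁ z ≠ 0 ∧ D₂ z ≠ 0 ∧ z ∉ Bset} with hU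
  have hUopen : IsOpen U := by
    rw [isOpen_iff_mem_nhds]
    rintro z ⟨hz, hz₁, hz₂, hzB⟩
    have e1 : ∀ᶠ w in 𝓝 z, D₁ w ≠ 0 := (han q₁ z hz).continuousAt.eventually_ne hz₁
    have e2 : ∀ᶠ w in 𝓝 z, D₂ w ≠ 0 := (han q₂ z hz).continuousAt.eventually_ne hz₂
    filter_upwards [hopen.mem_nhds hz, e1, e2, hBclosed.isOpen_compl.mem_nhds hzB]
      with w h0 h1 h2 h3 using ⟨h0, h1, h2, h3⟩
  set R : ℂ → ℂ := fun z ↦ N₁ z / D₁ z with hR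
  set K : ℂ → ℂ := fun z ↦ N₂ z / D₂ z with hK
  have hRd : DifferentiableOn ℂ R U := fun z hz ↦
    (((han p₁ z hz.1).differentiableAt).div (han q₁ z hz.1).differentiableAt
      hz.2.1).differentiableWithinAt
  have hKc : ContinuousOn K U := fun z hz ↦
    (((han p₂ z hz.1).continuousAt).div (han q₂ z hz.1).continuousAt hz.2.2.1).continuousWithinAt
  have hΨU : ∀ z ∈ U, z ∈ (G : Set ℂ) →
      Ψ z ∉ L.lattice ∧ ℘[L] (Ψ z) = R z ∧ ℘'[L] (Ψ z) / 2 = K z := by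
    intro z hz hzG
    obtain ⟨-, h1, -, -, -, h2, h3⟩ := hrat z hzG (hgood z hz.2.2.2)
    exact ⟨h1, h2, h3⟩
  -- Step 1: a generic division point `a`
  obtain ⟨n, hn, hgood₁, hgood₂⟩ := L.exists_generic_div_point T
  set a : ℂ := L.ω₁ / n with hadef
  have haG : a ∈ G := hdiv n hn _ L.ω₁_mem_lattice
  have haB : a ∉ Bset := fun ⟨t, ht, h⟩ ↦ hgood₁ t ht h
  have haaB : a + a ∉ Bset := fun ⟨t, ht, h⟩ ↦ hgood₂ t ht h
  obtain ⟨ha1, -, ha3, ha4, ha5, -, -⟩ := hrat a haG (hgood a haB)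
  obtain ⟨haa1, -, haa3, haa4, haa5, -, -⟩ := hrat (a + a) (G.add_mem haG haG) (hgood _ haaB)
  have haU : a ∈ U := ⟨ha1, ha4, ha5, haB⟩
  have haaU : a + a ∈ U := ⟨haa1, haa4, haa5, haaB⟩
  -- Step 2: local holomorphic lifts near `a` and `2a`
  obtain ⟨ε₁, hε₁, F₁, hsub₁, hF₁d, hF₁℘, hF₁Ψ⟩ :=
    L.exists_local_lift hUopen haU haG hRd hKc hΨU ha3
  obtain ⟨ε₂, hε₂, F₂, -, hF₂d, -, hF₂Ψ⟩ :=
    L.exists_local_lift hUopen haaU (G.add_mem haG haG) hRd hKc hΨU haa3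
  -- Step 3: the lift near `a` is affine
  have hdense : Dense (G : Set ℂ) := dense_of_div_mem hdiv
  obtain ⟨α, β, ε, hε, hεle, haff⟩ :=
    L.exists_eq_affine_of_lifts hdense hadd haG hε₁ hε₂ hF₁d hF₂d hF₁Ψ hF₂Ψ
  -- Step 4: `α` is not an integer
  have hαint : ∀ m : ℤ, α ≠ m := by
    intro m hαm
    obtain ⟨z, hzG, hz⟩ := hnint m
    apply hz
    -- small elements of `G`
    have hsmall : ∀ g ∈ G, ‖g‖ < ε → Ψ g - m * g ∈ L.lattice := by
      intro g hg hgε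
      have hag : a + g ∈ Metric.ball a ε := by
        simpa [Metric.mem_ball, dist_eq_norm] using hgε
      have h1 := hF₁Ψ (a + g) (Metric.ball_subset_ball hεle hag) (G.add_mem haG hg)
      have h2 := hF₁Ψ a (Metric.mem_ball_self hε₁) haG
      have h3 := hadd a haG g hg
      have e : Ψ g - m * g =
          -(Ψ (a + g) - Ψ a - Ψ g) - (F₁ (a + g) - Ψ (a + g)) + (F₁ a - Ψ a) := by
        rw [haff (a + g) hag, haff a (Metric.mem_ball_self hε), hαm]
        ring
      rw [e]
      exact add_mem (sub_mem (neg_mem h3) h1) h2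
    -- a general element of `G` is a small element plus a multiple of a small division point
    obtain ⟨N, l, hN, hl, hzl⟩ := L.exists_norm_sub_div_lt z hε
    obtain ⟨m', hm'⟩ := exists_nat_gt (‖l / N‖ / ε)
    have hm'pos : (0 : ℝ) < m' := lt_of_le_of_lt (by positivity) hm'
    have hm'0 : 0 < m' := by exact_mod_cast hm'pos
    have hN0 : (N : ℂ) ≠ 0 := by exact_mod_cast hN.ne'
    have hm'c : (m' : ℂ) ≠ 0 := by exact_mod_cast hm'0.ne'
    set g₂ : ℂ := l / ((N * m' : ℕ) : ℂ) with hg₂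
    have hg₂G : g₂ ∈ G := hdiv (N * m') (Nat.mul_pos hN hm'0) l hl
    have hmg₂ : (m' : ℂ) * g₂ = l / N := by
      rw [hg₂, Nat.cast_mul]; field_simp
    set g₁ : ℂ := z - m' * g₂ with hg₁
    have hg₁G : g₁ ∈ G := G.sub_mem hzG (by rw [hmg₂]; exact hdiv N hN l hl)
    have hg₁ε : ‖g₁‖ < ε := by rwa [hg₁, hmg₂]
    have hg₂ε : ‖g₂‖ < ε := by
      have e : g₂ = (l / N) / m' := by rw [← hmg₂]; field_simp
      rw [e, norm_div, Complex.norm_natCast, div_lt_iff₀ hm'pos]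
      rwa [div_lt_iff₀ hε, mul_comm] at hm'
    have h1 := hsmall g₁ hg₁G hg₁ε
    have h2 := hsmall g₂ hg₂G hg₂ε
    have h3 := sub_nsmul_mem_of_add hadd hg₂G m'
    have h4 := hadd g₁ hg₁G (m' * g₂) (by simpa using G.nsmul_mem hg₂G m')
    have e : Ψ z - m * z = (Ψ (g₁ + m' * g₂) - Ψ g₁ - Ψ (m' * g₂)) + (Ψ g₁ - m * g₁) +
        (Ψ (m' * g₂) - m' * Ψ g₂) + m' * (Ψ g₂ - m * g₂) := by
      rw [hg₁]; ring_nf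
    rw [e]
    refine add_mem (add_mem (add_mem h4 h1) h3) ?_
    simpa [nsmul_eq_mul] using nsmul_mem h2 m'
  have hα0 : α ≠ 0 := fun h ↦ hαint 0 (by rw [h, Int.cast_zero])
  -- Step 5: `℘(β + αζ) = N₁/D₁` near `a` forces `αΛ ⊆ Λ`
  refine ⟨α, hαint, fun l hl ↦ ?_⟩
  refine L.mul_mem_lattice_of_weierstrassP_affine_eq (c' := β) (z₀ := a) hα0 (han p₁) (han q₁)
    (hper p₁) (hper q₁) ha1 ?_ ha4 ?_ hl
  · have := (hF₁℘ a (Metric.mem_ball_self hε₁)).1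
    rwa [haff a (Metric.mem_ball_self hε), show α * a + β = β + α * a by ring] at this
  · filter_upwards [Metric.isOpen_ball.mem_nhds (Metric.mem_ball_self hε)] with ζ hζ
    have hζ₁ : ζ ∈ Metric.ball a ε₁ := Metric.ball_subset_ball hεle hζ
    obtain ⟨-, h℘F⟩ := hF₁℘ ζ hζ₁
    have hD₁ζ : D₁ ζ ≠ 0 := (hsub₁ hζ₁).2.1
    rw [haff ζ hζ, show α * ζ + β = β + α * ζ by ring] at h℘F
    rw [h℘F, hR]
    exact (div_mul_cancel₀ _ hD₁ζ).symm


/-! ### From an endomorphism of the curve `E_Λ` to the analytic core -/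

/-- The preimage of a finite set under an additive map with finite kernel is finite.
[folklore] -/
lemma finite_preimage_of_finite_ker {M N : Type*} [AddCommGroup M] [AddCommGroup N]
    (φ : M →+ N) (hker : (φ.ker : Set M).Finite) {A : Set N} (hA : A.Finite) :
    (φ ⁻¹' A).Finite := by
  have hA' : φ ⁻¹' A = ⋃ a ∈ A, φ ⁻¹' {a} := by ext m; simp
  rw [hA']
  refine hA.biUnion fun a _ ↦ ?_
  by_cases ha : ∃ m, φ m = a
  · obtain ⟨m₀, rfl⟩ := ha
    have : φ ⁻¹' {φ m₀} = (fun k ↦ k + m₀) '' (φ.ker : Set M) := by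
      ext m
      simp only [mem_preimage, mem_singleton_iff, mem_image, SetLike.mem_coe, AddMonoidHom.mem_ker]
      constructor
      · intro h
        exact ⟨m - m₀, by simp [map_sub, h], by abel⟩
      · rintro ⟨k, hk, rfl⟩
        simp [map_add, hk]
    rw [this]
    exact hker.image _
  · have : φ ⁻¹' {a} = ∅ := by
      ext m
      simp only [mem_preimage, mem_singleton_iff, mem_empty_iff_false, iff_false]
      exact fun h ↦ ha ⟨m, h⟩
    rw [this]
    exact Set.finite_empty

/-- **Endomorphisms of `E_Λ` are complex multiplications of `Λ`** (Silverman, *AEC*, VI.5.3 with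
VI.4.1(b), the direction `End(E) → End(Λ)`), in the following elementary form.  Let `M` be an
abstract group mapped injectively into `E_Λ(ℂ)` by `f` with image containing all torsion points,
and let `φ : M →+ M` be an additive map which, through `f`, is given off a finite set by a
rational map `(x, y) ↦ (p₁/q₁, p₂/q₂)(x, y)` and is not multiplication by any integer.  Then `Λ`
has complex multiplication.  (Apply `hasCM_of_rational_lift` to `G = π⁻¹(f(M))`,
`π : ℂ →+ E_Λ(ℂ)` the analytic parametrisation `z ↦ (℘ z, ℘' z/2)` of the tree's
`ComplexTorus.lean`, and a lift `Ψ` of `f ∘ φ ∘ f⁻¹ ∘ π` through `π`.)  In the application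
(`periodPair_hasCM_of_hasCM`), `M = E(ℚ̄)` for a model `E/ℚ` of `E_Λ`, `f` is induced by an
embedding `ℚ̄ ↪ ℂ`, and `φ` is a non-scalar element of `End_{ℚ̄}(E)`.
[cite: SilvermanAEC2009, Thm. VI.4.1(b) and Thm. VI.5.3] -/
theorem hasCM_of_curve_endomorphism {M : Type*} [AddCommGroup M] (φ : M →+ M)
    {W : WeierstrassCurve ℂ} (hW : W = L.curve) (f : M →+ W.toAffine.Point)
    (hf : Function.Injective f) (p₁ q₁ p₂ q₂ : MvPolynomial (Fin 2) ℂ)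
    (halg : {m : M | ¬ ∃ (x y : ℂ) (h : W.toAffine.Nonsingular x y),
        f m = .some x y h ∧ MvPolynomial.eval ![x, y] q₁ ≠ 0 ∧ MvPolynomial.eval ![x, y] q₂ ≠ 0 ∧
        ∃ h' : W.toAffine.Nonsingular
            (MvPolynomial.eval ![x, y] p₁ / MvPolynomial.eval ![x, y] q₁)
            (MvPolynomial.eval ![x, y] p₂ / MvPolynomial.eval ![x, y] q₂),
          f (φ m) = .some _ _ h'}.Finite)
    (htors : ∀ n : ℕ, 0 < n → ∀ P : W.toAffine.Point, n • P = 0 → P ∈ f.range)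
    (hne : ∀ n : ℤ, ∃ m, φ m ≠ n • m) : L.HasCM := by
  subst hW
  classical
  set π : ℂ →+ L.curve.toAffine.Point := toPointHom (toPoint_add_holds (L := L)) with hπ
  have hπapp : ∀ z, π z = L.toPoint z := fun z ↦ rfl
  -- the group `G = π⁻¹(f(M))` and the section `μ : G → M`
  set G : AddSubgroup ℂ := f.range.comap π with hG
  have hmemG : ∀ z, z ∈ G ↔ ∃ m, f m = L.toPoint z := fun z ↦ by
    simp only [hG, AddSubgroup.mem_comap, AddMonoidHom.mem_range, hπapp]
  set μ : ℂ → M := fun z ↦ if h : ∃ m, f m = L.toPoint z then h.choose else 0 with hμ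
  have hμspec : ∀ z ∈ G, f (μ z) = L.toPoint z := by
    intro z hz
    have h := (hmemG z).1 hz
    simp only [hμ, dif_pos h]
    exact h.choose_spec
  have hμadd : ∀ z ∈ G, ∀ w ∈ G, μ (z + w) = μ z + μ w := by
    intro z hz w hw
    apply hf
    rw [map_add, hμspec z hz, hμspec w hw, hμspec (z + w) (G.add_mem hz hw)]
    exact toPoint_add_holds (L := L) z w
  -- the lift `Ψ`
  set Ψ : ℂ → ℂ := fun z ↦ (L.toPoint_surjective (f (φ (μ z)))).choose with hΨ
  have hΨspec : ∀ z, L.toPoint (Ψ z) = f (φ (μ z)) := fun z ↦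
    (L.toPoint_surjective (f (φ (μ z)))).choose_spec
  have hadd : ∀ z ∈ G, ∀ w ∈ G, Ψ (z + w) - Ψ z - Ψ w ∈ L.lattice := by
    intro z hz w hw
    have h : L.toPoint (Ψ (z + w)) = L.toPoint (Ψ z + Ψ w) := by
      rw [toPoint_add_holds (L := L), hΨspec, hΨspec, hΨspec, hμadd z hz w hw, map_add, map_add]
    have := L.toPoint_eq_toPoint_iff.1 h
    rwa [show Ψ (z + w) - (Ψ z + Ψ w) = Ψ (z + w) - Ψ z - Ψ w by ring] at this
  -- division points lie in `G`
  have hdiv : ∀ n : ℕ, 0 < n → ∀ l ∈ L.lattice, l / n ∈ G := by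
    intro n hn l hl
    rw [hG, AddSubgroup.mem_comap]
    refine htors n hn _ ?_
    rw [← map_nsmul, hπapp, nsmul_eq_mul, mul_div_cancel₀ _ (by exact_mod_cast hn.ne')]
    exact toPoint_of_mem hl
  -- the exceptional set: non-agreeing points, and points mapped to `E[2]`
  set S : Set M := {m : M | ¬ ∃ (x y : ℂ) (h : L.curve.toAffine.Nonsingular x y),
        f m = .some x y h ∧ MvPolynomial.eval ![x, y] q₁ ≠ 0 ∧ MvPolynomial.eval ![x, y] q₂ ≠ 0 ∧
        ∃ h' : L.curve.toAffine.Nonsingular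
            (MvPolynomial.eval ![x, y] p₁ / MvPolynomial.eval ![x, y] q₁)
            (MvPolynomial.eval ![x, y] p₂ / MvPolynomial.eval ![x, y] q₂),
          f (φ m) = .some _ _ h'} with hS
  have hSfin : S.Finite := halg
  have hker : (φ.ker : Set M).Finite := by
    refine hSfin.subset fun m hm ↦ ?_
    simp only [SetLike.mem_coe, AddMonoidHom.mem_ker] at hm
    rintro ⟨x, y, h, -, -, -, h', hφ⟩
    rw [hm, map_zero] at hφ
    exact (WeierstrassCurve.Affine.Point.some_ne_zero h') hφ.symm
  set E2 : Set L.curve.toAffine.Point :=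
    (AddSubgroup.torsionBy L.curve.toAffine.Point ((2 : ℕ) : ℤ) : Set L.curve.toAffine.Point)
    with hE2
  have hE2fin : E2.Finite := by
    have hcard := WeierstrassCurve.card_torsionBy_eq_sq (E := L.curve) (n := 2) (by norm_num)
    have : Finite (AddSubgroup.torsionBy L.curve.toAffine.Point ((2 : ℕ) : ℤ)) :=
      Nat.finite_of_card_ne_zero (by rw [hcard]; norm_num)
    exact Set.toFinite _
  set S₂ : Set M := S ∪ φ ⁻¹' (f ⁻¹' E2) with hS₂
  have hS₂fin : S₂.Finite :=
    hSfin.union (finite_preimage_of_finite_ker φ hker (hE2fin.preimage hf.injOn))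
  -- lifts of the exceptional points to `ℂ`, and the finite set `T` of bad cosets
  set lift : L.curve.toAffine.Point → ℂ := fun P ↦ (L.toPoint_surjective P).choose with hlift
  have hliftspec : ∀ P, L.toPoint (lift P) = P := fun P ↦ (L.toPoint_surjective P).choose_spec
  set Tset : Set ℂ := (fun m ↦ lift (f m)) '' S₂ ∪ {0} with hTset
  have hTfin : Tset.Finite := (hS₂fin.image _).union (Set.finite_singleton 0)
  set T : Finset ℂ := hTfin.toFinset with hT
  have hmemT : ∀ t, t ∈ T ↔ t ∈ Tset := fun t ↦ hTfin.mem_toFinset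
  -- the rational description off `T + Λ`
  have hrat : ∀ z ∈ G, (∀ t ∈ T, z - t ∉ L.lattice) →
      z ∉ L.lattice ∧ Ψ z ∉ L.lattice ∧ ℘'[L] (Ψ z) ≠ 0 ∧
      MvPolynomial.eval ![℘[L] z, ℘'[L] z / 2] q₁ ≠ 0 ∧
      MvPolynomial.eval ![℘[L] z, ℘'[L] z / 2] q₂ ≠ 0 ∧
      ℘[L] (Ψ z) = MvPolynomial.eval ![℘[L] z, ℘'[L] z / 2] p₁ /
        MvPolynomial.eval ![℘[L] z, ℘'[L] z / 2] q₁ ∧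
      ℘'[L] (Ψ z) / 2 = MvPolynomial.eval ![℘[L] z, ℘'[L] z / 2] p₂ /
        MvPolynomial.eval ![℘[L] z, ℘'[L] z / 2] q₂ := by
    intro z hzG hzT
    have hz0 : z ∉ L.lattice := by
      have := hzT 0 ((hmemT 0).2 (Or.inr rfl))
      rwa [sub_zero] at this
    set m₀ := μ z with hm₀
    have hm₀spec : f m₀ = L.toPoint z := hμspec z hzG
    have hm₀S₂ : m₀ ∉ S₂ := by
      intro hmem
      have ht : lift (f m₀) ∈ T := (hmemT _).2 (Or.inl ⟨m₀, hmem, rfl⟩)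
      apply hzT _ ht
      apply L.toPoint_eq_toPoint_iff.1
      rw [hliftspec, hm₀spec]
    have hm₀S : m₀ ∉ S := fun h ↦ hm₀S₂ (Or.inl h)
    have hm₀E2 : f (φ m₀) ∉ E2 := fun h ↦ hm₀S₂ (Or.inr h)
    simp only [hS, mem_setOf_eq, not_not] at hm₀S
    obtain ⟨x, y, hxy, hfm, hq₁, hq₂, h', hfφ⟩ := hm₀S
    rw [hm₀spec, toPoint_of_notMem hz0] at hfm
    obtain ⟨rfl, rfl⟩ : x = ℘[L] z ∧ y = ℘'[L] z / 2 :=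
      WeierstrassCurve.Affine.Point.some.inj hfm.symm
    have hΨz' : L.toPoint (Ψ z) = f (φ m₀) := by rw [hm₀]; exact hΨspec z
    have hΨz := hΨz'
    rw [hfφ] at hΨz
    have hΨ0 : Ψ z ∉ L.lattice := by
      intro hmem
      rw [toPoint_of_mem hmem] at hΨz
      exact (WeierstrassCurve.Affine.Point.some_ne_zero h') hΨz.symm
    rw [toPoint_of_notMem hΨ0] at hΨz
    obtain ⟨h℘, h℘'⟩ := WeierstrassCurve.Affine.Point.some.inj hΨz
    refine ⟨hz0, hΨ0, fun h0 ↦ hm₀E2 ?_, hq₁, hq₂, h℘, h℘'⟩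
    -- `℘'(Ψ z) = 0` would make `f (φ m₀) = π (Ψ z)` a `2`-torsion point
    have hP : L.toPoint (Ψ z) = -L.toPoint (Ψ z) := by
      rw [toPoint_of_notMem hΨ0, WeierstrassCurve.Affine.Point.neg_some]
      simp only [WeierstrassCurve.Affine.negY, WeierstrassCurve.toAffine, curve_a₁, curve_a₃]
      congr 1
      rw [h0]; ring
    rw [hE2, SetLike.mem_coe, AddSubgroup.torsionBy.nsmul_iff, ← hΨz', two_nsmul,
      add_eq_zero_iff_eq_neg]
    exact hP
  -- non-integrality
  have hnint : ∀ n : ℤ, ∃ z ∈ G, Ψ z - n * z ∉ L.lattice := by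
    intro n
    obtain ⟨m₁, hm₁⟩ := hne n
    obtain ⟨z, hz⟩ := L.toPoint_surjective (f m₁)
    have hzG : z ∈ G := (hmemG z).2 ⟨m₁, hz.symm⟩
    have hμz : μ z = m₁ := hf (by rw [hμspec z hzG, hz])
    refine ⟨z, hzG, fun hmem ↦ hm₁ (hf ?_)⟩
    have h1 : L.toPoint (Ψ z) = L.toPoint (n * z) := L.toPoint_eq_toPoint_iff.2 hmem
    rw [hΨspec, hμz] at h1
    rw [h1, map_zsmul, ← hz, ← hπapp, ← hπapp, ← map_zsmul, zsmul_eq_mul]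
  exact L.hasCM_of_rational_lift G hdiv Ψ hadd p₁ q₁ p₂ q₂ T hrat hnint

end PeriodPair

end
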